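import Literature.NumberTheory.Automorphic.OrdinaryCompletedCohomologyGL
import Literature.NumberTheory.Automorphic.CuspidalCohomologyGL
import HarnessLib

/-!
# Hecke operators of central elements are invertible: `T_{z⁻¹} ∘ T_z = id`

Topic `NumberTheory/Automorphic`; namespace `Literature.NumberTheory.Automorphic.TwistedQuotient`.
Theorems only; no named fact, no instance, no `sorry`.

For `z ∈ 𝒢` commuting with everything (e.g. the scalar element `t_{v,n} = ϖ_v · 1` of
`GL_n(𝔸_K^∞)`), the double coset `L z L = z L` is a single coset and `T_z` is translation by `z`
(`ArithmeticQuotient.heckeFun_apply_mk_of_conj`); hence `T_z ≫ T_{z⁻¹} = 𝟙` on `Fun(𝒢/L, V)_ρ`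
(`heckeRepHom_comp_inv_of_commute`) and on `H^q(S_L, Ṽ)` (`heckeEnd_inv_heckeEnd_of_commute`),
and an eigenvector of `T_z` with eigenvalue `c` has `c ≠ 0` and is an eigenvector of `T_{z⁻¹}`
with eigenvalue `c⁻¹` (`heckeEnd_inv_eq_inv_smul_of_eigen`) — the values of a Hecke eigensystem on
the generators `T_{v,n}⁻¹` of `𝕋(K^p)` [Scholze2015, §V.4].

## References

* G. Shimura, *Introduction to the arithmetic theory of automorphic functions* (1971), Ch. 3,
  §3.1. [ShimuraIATAF1971]
* P. Scholze, Ann. of Math. 182 (2015), §V.4. [Scholze2015]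
-/

noncomputable section

open CategoryTheory

namespace Literature.NumberTheory.Automorphic

namespace TwistedQuotient

variable {k : Type} [CommRing k] {Γ 𝒢 : Type} [Group Γ] [Group 𝒢] (ι : Γ →* 𝒢)
  (L : Subgroup 𝒢) {V : Type} [AddCommGroup V] [Module k V] (ρ : Representation k Γ V)

/-- For `z` commuting with `𝒢`, `z⁻¹ l z = l ∈ L`. [folklore] -/
theorem conj_mem_of_commute {z : 𝒢} (hz : ∀ x : 𝒢, Commute z x) (L₀ : Subgroup 𝒢) :
    ∀ l ∈ L₀, z⁻¹ * l * z ∈ L₀ := fun l hl => by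
  have h : z⁻¹ * l * z = l := by
    rw [mul_assoc, ← (hz l).eq, ← mul_assoc, inv_mul_cancel, one_mul]
  rwa [h]

/-- `T_z` for `z` commuting with `𝒢` is right translation: `(T_z f)(xL) = f(x z L)`. [folklore] -/
theorem heckeFun_apply_mk_of_commute {z : 𝒢} (hz : ∀ x : 𝒢, Commute z x) (f : (𝒢 ⧸ L) → V)
    (x : 𝒢) :
    ArithmeticQuotient.heckeFun k L z V f (x : 𝒢 ⧸ L) = f ((x * z : 𝒢) : 𝒢 ⧸ L) :=
  ArithmeticQuotient.heckeFun_apply_mk_of_conj k V (conj_mem_of_commute hz L) f x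

/-- **`T_z ≫ T_{z⁻¹} = 𝟙`** on `Fun(𝒢/L, V)_ρ` for `z` commuting with `𝒢`.
[cite: ShimuraIATAF1971, Ch. 3, §3.1] -/
theorem heckeRepHom_comp_inv_of_commute {z : 𝒢} (hz : ∀ x : 𝒢, Commute z x) :
    heckeRepHom ι L ρ z ≫ heckeRepHom ι L ρ z⁻¹ = 𝟙 (coeffRep ι L ρ) := by
  have hz' : ∀ x : 𝒢, Commute z⁻¹ x := fun x => (hz x).inv_left
  refine Rep.hom_ext (Representation.IntertwiningMap.ext (LinearMap.ext fun f => funext fun c => ?_))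
  change ArithmeticQuotient.heckeFun k L z⁻¹ V (ArithmeticQuotient.heckeFun k L z V f) c = f c
  induction c using QuotientGroup.induction_on with
  | H x =>
    rw [heckeFun_apply_mk_of_commute L hz', heckeFun_apply_mk_of_commute L hz,
      inv_mul_cancel_right]

/-- **`T_{z⁻¹} (T_z y) = y`** on `H^q(S_L, Ṽ)` for `z` commuting with `𝒢`. [folklore] -/
theorem heckeEnd_inv_heckeEnd_of_commute {z : 𝒢} (hz : ∀ x : 𝒢, Commute z x) (q : ℕ)
    (y : cohomology ι L ρ q) :
    heckeEnd ι L ρ z⁻¹ q (heckeEnd ι L ρ z q y) = y := by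
  change ((heckeOperator ι L ρ z q) ≫ (heckeOperator ι L ρ z⁻¹ q)).hom y = y
  rw [heckeOperator, heckeOperator, ← groupCohomology.map_id_comp,
    heckeRepHom_comp_inv_of_commute ι L ρ hz, groupCohomology.map_id]
  rfl

/-- **Eigenvalues on `T_z` are units and invert on `T_{z⁻¹}`**: if `T_z y = c y` with `y ≠ 0`
(`k` a field) then `c ≠ 0` and `T_{z⁻¹} y = c⁻¹ y`. [folklore] -/
theorem heckeEnd_inv_eq_inv_smul_of_eigen {k' : Type} [Field k'] {V' : Type} [AddCommGroup V']
    [Module k' V'] (ρ' : Representation k' Γ V') {z : 𝒢} (hz : ∀ x : 𝒢, Commute z x) (q : ℕ)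
    {y : cohomology ι L ρ' q} (hy : y ≠ 0) {c : k'} (hc : heckeEnd ι L ρ' z q y = c • y) :
    c ≠ 0 ∧ heckeEnd ι L ρ' z⁻¹ q y = c⁻¹ • y := by
  have h := heckeEnd_inv_heckeEnd_of_commute ι L ρ' hz q y
  rw [hc, map_smul] at h
  have hc0 : c ≠ 0 := by
    rintro rfl
    rw [zero_smul] at h
    exact hy h.symm
  refine ⟨hc0, ?_⟩
  calc heckeEnd ι L ρ' z⁻¹ q y = c⁻¹ • (c • heckeEnd ι L ρ' z⁻¹ q y) := by
        rw [smul_smul, inv_mul_cancel₀ hc0, one_smul]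
    _ = c⁻¹ • y := by rw [h]

end TwistedQuotient

end Literature.NumberTheory.Automorphic
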